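import Literature.NumberTheory.EllipticCurves.NeronComponentIndex
import Literature.NumberTheory.EllipticCurves.NeronTamagawa
import Literature.NumberTheory.EllipticCurves.NeronModelProofs
import Literature.NumberTheory.EllipticCurves.KodairaNeron
import Literature.NumberTheory.EllipticCurves.TamagawaNeZeroProofs
import Literature.NumberTheory.EllipticCurves.TamagawaProofs
import Mathlib.GroupTheory.SpecificGroups.Cyclic
import Mathlib.Algebra.Group.Shrink
import Mathlib.Data.Countable.Small
import HarnessLib

/-!
# Assembly of `nonempty_neronComponentData` from the local index table

Topic `EllipticCurves`; second file of the decomposition of the named fact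
`Literature.NumberTheory.EllipticCurves.nonempty_neronComponentData` (`NeronModel.lean`;
Kodaira–Néron–Tate). Theorems only.

**Main result.** `Literature.NumberTheory.EllipticCurves.nonempty_neronComponentData_of_localIndex`:
the nine named facts of `NeronComponentIndex.lean` — the values of
`c_v = [E(K_v) : E₀(K_v)]` printed in Steps 2–10 of Tate's algorithm (Silverman, *ATAEC*,
IV.9.4, PDF pp. 341–346), read over the complete field `K_v` — together with the split
multiplicative case in the form already in the tree, the named fact
`WeierstrassCurve.index_goodReductionSubgroup_of_hasSplitMultiplicativeReduction` of
`KodairaNeron.lean` (*ATAEC*, Cor. IV.9.2(d) over a Henselian ring) instantiated at `R := O_v`,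
`W := W.localMinimalModel v`, imply `nonempty_neronComponentData W v`. Consequently, discharging
those ten statements about points of a minimal Weierstrass equation over `K_v` discharges the
Néron-model fact.

**Proof.** The hypothesis structure `NeronComponentData W v` records only a finite abelian group
`Φ` with `#Φ = componentGroupOrder (W.kodairaSymbolAt v)`, an automorphism `frob`, and an
isomorphism `Φ^{frob} ≃+ E(K_v)/E₀(K_v)`; so, once `c_v` is known, `(Φ, frob)` can be written
down abstractly, following the Frobenius actions on the geometric component groups of
Table 4.1 (*ATAEC*, PDF p. 343):

* `c_v = #Φ(k̄)` (all components rational: `I₀`; split `Iₙ`; `II`, `III`, `III*`, `II*`; and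
  `IV`, `IV*`, `Iₙ*` in the rational alternative): `Φ := E(K_v)/E₀(K_v)` itself, shrunk to
  `Type` (it is finite: `finite_quotient_goodReductionSubgroup_localMinimalModel`, from the tree's
  `WeierstrassCurve.index_goodReductionSubgroup_ne_zero_of_Δ_ne_zero`), `frob := id`
  (`nonempty_neronComponentData_of_eq_componentGroupOrder`);
* `c_v = 2` or `1` according to the parity of `n = #Φ(k̄)` (non-split `Iₙ`; `IV`, `IV*` with
  `c = 1`; `Iₙ*` with `c = 2`): `Φ := ℤ/nℤ`, `frob := -1`, whose fixed group `{x : 2x = 0}` has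
  order `2` or `1` (`NeronComponentData.natCard_neg_eq_self_of_even/odd`,
  `nonempty_neronComponentData_of_neg`);
* `#Φ(k̄) = 4`, `c_v = 1` (`I₀*` with `P(T)` irreducible over `k`): `Φ := (ℤ/2ℤ)²` with the
  order-`3` automorphism `(a, b) ↦ (b, a + b)` (`nonempty_neronComponentData_of_klein`).

In the last two cases `Φ^{frob} ≃+ E(K_v)/E₀(K_v)` exists because both groups have the same
order, `1` or a prime (`NeronComponentData.nonempty_addEquiv_of_natCard_eq`). The case split is
on `W.kodairaSymbolAt v`; Step 1 (`I₀ ↔` good reduction, `c = 1`) and Step 2 (`Iₙ`, `n ≥ 1`,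
`↔` multiplicative reduction with `n = ord_v(Δ_min)`) are the tree's
`WeierstrassCurve.isGood_kodairaSymbolAt_iff_holds`,
`WeierstrassCurve.kodairaSymbolAt_eq_I_iff_holds` (`TateAlgorithmProofs`) and
`WeierstrassCurve.localTamagawaNumber_eq_one_of_hasGoodReduction_holds` (`TamagawaProofs`).

The split multiplicative input enters through the bridge
`localTamagawaNumber_eq_ordMinimalDiscriminant_of_kodairaNeron`: at `R := O_v` (Henselian:
`IsDedekindDomain.HeightOneSpectrum.adicCompletionIntegers.isAdicComplete` and Mathlib's
`IsAdicComplete.henselianRing`) the `KodairaNeron` fact gives `v(Δ) = exp(−c_v)` for the local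
minimal model, i.e. `c_v = ord_v(Δ_min)` (`toNat_addVal_eq_of_intValuation_eq`: the valuation of
`K_v` at the maximal ideal of `O_v` versus `IsDiscreteValuationRing.addVal` on `O_v`).

## References

* J. H. Silverman, *Advanced Topics in the Arithmetic of Elliptic Curves*, GTM 151, Springer
  1994, §IV.9: Cor. 9.2 (PDF p. 340), Rem. 9.3 and Algorithm 9.4 (PDF pp. 341–346), Table 4.1
  (PDF p. 343). [SilvermanATAEC1994]

## Design

No definitions (the order-`3` automorphism of `(ℤ/2ℤ)²` is a local `let`); `noncomputable
section`, `open scoped Classical`.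
-/

noncomputable section

open scoped Classical

open IsDedekindDomain

namespace Literature.NumberTheory.EllipticCurves

/-! ### Abstract finite abelian groups with an automorphism -/

namespace NeronComponentData

/-- Two finite abelian groups of the same order are isomorphic when that order is `1` or a
prime (a group of prime order is cyclic). Used to identify the fixed group of the abstract
Frobenius with `E(K_v)/E₀(K_v)` from a computation of orders alone. [folklore] -/
theorem nonempty_addEquiv_of_natCard_eq {G H : Type*} [AddCommGroup G] [AddCommGroup H]
    [Finite G] [Finite H] (h : Nat.card G = Nat.card H)
    (h1 : Nat.card G = 1 ∨ (Nat.card G).Prime) : Nonempty (G ≃+ H) := by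
  rcases h1 with h1 | hp
  · haveI : Subsingleton G := (Nat.card_eq_one_iff_unique.mp h1).1
    haveI : Subsingleton H := (Nat.card_eq_one_iff_unique.mp (h ▸ h1 : Nat.card H = 1)).1
    haveI : Unique G := uniqueOfSubsingleton 0
    haveI : Unique H := uniqueOfSubsingleton 0
    exact ⟨AddEquiv.ofUnique⟩
  · haveI : Fact (Nat.card G).Prime := ⟨hp⟩
    haveI : IsAddCyclic G := isAddCyclic_of_prime_card (p := Nat.card G) rfl
    haveI : IsAddCyclic H := isAddCyclic_of_prime_card (p := Nat.card G) h.symm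
    exact ⟨addEquivOfAddCyclicCardEq h⟩

/-- On `ℤ/mℤ` with `m` odd, negation fixes only `0` (`-x = x ↔ 2x = 0` and `2` is a unit).
This is the Frobenius `-1` on the component group `ℤ/nℤ` of a non-split `Iₙ`, `n` odd
(`c = 1`), and on `ℤ/3ℤ` for `IV`, `IV*` with `c = 1`. [folklore] -/
theorem natCard_neg_eq_self_of_odd {m : ℕ} (hm : Odd m) :
    Nat.card {x : ZMod m // -x = x} = 1 := by
  haveI : NeZero m := ⟨hm.pos.ne'⟩
  rw [Nat.card_eq_one_iff_unique]
  refine ⟨⟨fun a b => Subtype.ext ?_⟩, ⟨⟨0, by simp⟩⟩⟩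
  have key : ∀ x : ZMod m, -x = x → x = 0 := by
    intro x hx
    rcases (ZMod.neg_eq_self_iff x).mp hx with h | h
    · exact h
    · exact absurd (h ▸ even_two_mul x.val) (Nat.not_even_iff_odd.mpr hm)
  rw [key a.1 a.2, key b.1 b.2]

/-- On `ℤ/mℤ` with `m ≠ 0` even, negation fixes exactly `0` and `m/2`. This is the Frobenius
`-1` on the component group `ℤ/nℤ` of a non-split `Iₙ`, `n` even (`c = 2`), and on `ℤ/4ℤ` for
`Iₙ*` with `c = 2`. [folklore] -/
theorem natCard_neg_eq_self_of_even {m : ℕ} (hm : Even m) (h0 : m ≠ 0) :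
    Nat.card {x : ZMod m // -x = x} = 2 := by
  haveI : NeZero m := ⟨h0⟩
  obtain ⟨k, rfl⟩ := hm
  have hkval : ((k : ZMod (k + k))).val = k := ZMod.val_cast_of_lt (by omega)
  have hk0 : (k : ZMod (k + k)) ≠ 0 := by
    intro h
    have := congrArg ZMod.val h
    rw [hkval, ZMod.val_zero] at this
    omega
  have key : ∀ x : ZMod (k + k), -x = x ↔ x = 0 ∨ x = (k : ZMod (k + k)) := by
    intro x
    rw [ZMod.neg_eq_self_iff]
    apply or_congr Iff.rfl
    constructor
    · intro h
      apply ZMod.val_injective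
      rw [hkval]; omega
    · rintro rfl
      rw [hkval]; ring
  rw [Nat.card_eq_fintype_card, Fintype.card_subtype]
  have : (Finset.univ.filter fun x : ZMod (k + k) => -x = x) = {0, (k : ZMod (k + k))} := by
    ext x; simp [key]
  rw [this, Finset.card_pair hk0.symm]

end NeronComponentData

/-! ### Models for the datum and the assembly -/

section Assembly

variable {A : Type*} [CommRing A] [IsDedekindDomain A] {K : Type*} [Field K] [Algebra A K]
  [IsFractionRing A K] (v : HeightOneSpectrum A) (W : WeierstrassCurve K)

/-- `E(K_v)/E₀(K_v)` is finite at a place with finite residue field (Silverman, *AEC*,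
Cor. VII.6.2; the tree's `WeierstrassCurve.index_goodReductionSubgroup_ne_zero_of_Δ_ne_zero`
applied to the local minimal model). [cite: SilvermanAEC2009, VII.6 Cor. 6.2 (PDF p. 194)] -/
theorem finite_quotient_goodReductionSubgroup_localMinimalModel [W.IsElliptic]
    [Finite (IsLocalRing.ResidueField (v.adicCompletionIntegers K))] :
    Finite ((W.localMinimalModel v).toAffine.Point ⧸
      (W.localMinimalModel v).goodReductionSubgroup (v.adicCompletionIntegers K)) := by
  haveI := W.isElliptic_localMinimalModel v
  exact Nat.finite_of_card_ne_zero
    (WeierstrassCurve.index_goodReductionSubgroup_ne_zero_of_Δ_ne_zero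
      (R := v.adicCompletionIntegers K) (W.localMinimalModel v)
      (W.localMinimalModel v).Δ'.ne_zero)

variable {v W} in
/-- **Abstract model ⟹ datum.** A finite abelian group `Φ₀` with an automorphism `f₀` such that
`#Φ₀` is the component-group order of the Kodaira symbol and `#Fix(f₀) = c_v ∈ {1} ∪ {primes}`
yields a `NeronComponentData W v` (the fixed group and `E(K_v)/E₀(K_v)` are then isomorphic,
`NeronComponentData.nonempty_addEquiv_of_natCard_eq`). [folklore] -/
theorem nonempty_neronComponentData_of_model [W.IsElliptic]
    [Finite (IsLocalRing.ResidueField (v.adicCompletionIntegers K))]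
    (Φ₀ : Type) [Fintype Φ₀] [AddCommGroup Φ₀] (f₀ : Φ₀ ≃+ Φ₀)
    (hcard : Fintype.card Φ₀ = (W.kodairaSymbolAt v).componentGroupOrder)
    (hfix : Nat.card (f₀.toAddMonoidHom.eqLocus (AddMonoidHom.id Φ₀)) =
      (W.baseChange (v.adicCompletion K)).localTamagawaNumber (v.adicCompletionIntegers K))
    (hc : (W.baseChange (v.adicCompletion K)).localTamagawaNumber (v.adicCompletionIntegers K) = 1 ∨
      ((W.baseChange (v.adicCompletion K)).localTamagawaNumber
        (v.adicCompletionIntegers K)).Prime) :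
    Nonempty (NeronComponentData W v) := by
  haveI := finite_quotient_goodReductionSubgroup_localMinimalModel v W
  -- `c_v` *is* `Nat.card (E(K_v)/E₀(K_v))`: `localTamagawaNumber` is an `AddSubgroup.index`
  change Nat.card _ = Nat.card ((W.localMinimalModel v).toAffine.Point ⧸
    (W.localMinimalModel v).goodReductionSubgroup (v.adicCompletionIntegers K)) at hfix
  change Nat.card ((W.localMinimalModel v).toAffine.Point ⧸
      (W.localMinimalModel v).goodReductionSubgroup (v.adicCompletionIntegers K)) = 1 ∨
    (Nat.card ((W.localMinimalModel v).toAffine.Point ⧸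
      (W.localMinimalModel v).goodReductionSubgroup (v.adicCompletionIntegers K))).Prime at hc
  obtain ⟨e⟩ := NeronComponentData.nonempty_addEquiv_of_natCard_eq hfix (hfix ▸ hc)
  exact ⟨{ Φ := Φ₀, frob := f₀, card_eq := hcard, fixedPointsEquiv := e }⟩

variable {v W} in
/-- **All components rational.** If `c_v = #Φ(k̄)` (the component-group order of the Kodaira
symbol), take `Φ := E(K_v)/E₀(K_v)` itself (shrunk to `Type`; it is finite) with the trivial
Frobenius. [folklore] -/
theorem nonempty_neronComponentData_of_eq_componentGroupOrder [W.IsElliptic]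
    [Finite (IsLocalRing.ResidueField (v.adicCompletionIntegers K))]
    (hc : (W.baseChange (v.adicCompletion K)).localTamagawaNumber (v.adicCompletionIntegers K) =
      (W.kodairaSymbolAt v).componentGroupOrder) :
    Nonempty (NeronComponentData W v) := by
  haveI := finite_quotient_goodReductionSubgroup_localMinimalModel v W
  set Q := (W.localMinimalModel v).toAffine.Point ⧸
    (W.localMinimalModel v).goodReductionSubgroup (v.adicCompletionIntegers K)
  letI : Fintype Q := Fintype.ofFinite Q
  letI : Fintype (Shrink.{0} Q) := Fintype.ofEquiv Q (equivShrink.{0} Q)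
  refine ⟨{ Φ := Shrink.{0} Q, frob := AddEquiv.refl _, card_eq := ?_, fixedPointsEquiv := ?_ }⟩
  · rw [Fintype.ofEquiv_card, ← hc, ← Nat.card_eq_fintype_card]
    rfl
  · refine (AddEquiv.addSubgroupCongr ?_).trans (AddSubgroup.topEquiv.trans Shrink.addEquiv)
    exact AddMonoidHom.eqLocus_same _

variable {v W} in
/-- **Frobenius `-1` on `ℤ/nℤ`.** If `c_v = 2` or `1` according as the component-group order
`n ≠ 0` of the Kodaira symbol is even or odd, take `Φ := ℤ/nℤ` with `frob := -1`. Cases non-split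
`Iₙ`; `IV`, `IV*` with `c = 1` (`n = 3`); `Iₙ*` with `c = 2` (`n = 4`). [folklore] -/
theorem nonempty_neronComponentData_of_neg [W.IsElliptic]
    [Finite (IsLocalRing.ResidueField (v.adicCompletionIntegers K))]
    (h0 : (W.kodairaSymbolAt v).componentGroupOrder ≠ 0)
    (hc : (W.baseChange (v.adicCompletion K)).localTamagawaNumber (v.adicCompletionIntegers K) =
      if Even (W.kodairaSymbolAt v).componentGroupOrder then 2 else 1) :
    Nonempty (NeronComponentData W v) := by
  set n := (W.kodairaSymbolAt v).componentGroupOrder with hn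
  haveI : NeZero n := ⟨h0⟩
  refine nonempty_neronComponentData_of_model (ZMod n) (AddEquiv.neg _) (ZMod.card n) ?_ ?_
  · rw [hc]
    have e : Nat.card ((AddEquiv.neg (ZMod n)).toAddMonoidHom.eqLocus
        (AddMonoidHom.id (ZMod n))) = Nat.card {x : ZMod n // -x = x} := rfl
    rw [e]
    split_ifs with he
    · exact NeronComponentData.natCard_neg_eq_self_of_even he h0
    · exact NeronComponentData.natCard_neg_eq_self_of_odd (Nat.not_even_iff_odd.mp he)
  · rw [hc]
    split_ifs
    · exact Or.inr Nat.prime_two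
    · exact Or.inl rfl

variable {v W} in
/-- **Order-3 Frobenius on `(ℤ/2ℤ)²`.** If the component-group order is `4` and `c_v = 1`
(type `I₀*` with `P(T)` irreducible over `k`), take `Φ := (ℤ/2ℤ)²` with the automorphism
`(a, b) ↦ (b, a + b)`, which permutes the three non-zero elements cyclically and fixes only `0`.
[folklore] -/
theorem nonempty_neronComponentData_of_klein [W.IsElliptic]
    [Finite (IsLocalRing.ResidueField (v.adicCompletionIntegers K))]
    (h4 : (W.kodairaSymbolAt v).componentGroupOrder = 4)
    (hc : (W.baseChange (v.adicCompletion K)).localTamagawaNumber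
      (v.adicCompletionIntegers K) = 1) :
    Nonempty (NeronComponentData W v) := by
  let f : ZMod 2 × ZMod 2 ≃+ ZMod 2 × ZMod 2 :=
    { toFun := fun p => (p.2, p.1 + p.2)
      invFun := fun p => (p.1 + p.2, p.1)
      left_inv := by decide
      right_inv := by decide
      map_add' := by decide }
  refine nonempty_neronComponentData_of_model (ZMod 2 × ZMod 2) f (by rw [h4]; rfl) ?_
    (Or.inl hc)
  rw [hc]
  change Nat.card {p : ZMod 2 × ZMod 2 // f p = p} = 1
  rw [Nat.card_eq_fintype_card, Fintype.card_subtype]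
  decide

/-- **`addVal` versus the valuation at the maximal ideal.** In a discrete valuation ring `R`, if
the `𝔪`-adic valuation of `r ≠ 0` (Mathlib's `HeightOneSpectrum.intValuation` at
`IsDiscreteValuationRing.maximalIdeal R`, values in `ℤᵐ⁰`) is `exp (−c)`, then
`c = (addVal R r).toNat`: both sides count the powers of a uniformiser dividing `r`
(`intValuation_le_pow_iff_mem` and `pow_dvd_iff_le_addVal`). [folklore] -/
theorem toNat_addVal_eq_of_intValuation_eq {R : Type*} [CommRing R] [IsDomain R]
    [IsDiscreteValuationRing R] {r : R} (hr : r ≠ 0) {c : ℕ}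
    (h : (IsDiscreteValuationRing.maximalIdeal R).intValuation r = WithZero.exp (-(c : ℤ))) :
    (IsDiscreteValuationRing.addVal R r).toNat = c := by
  have key : ∀ n : ℕ, n ≤ c ↔ (n : ℕ∞) ≤ IsDiscreteValuationRing.addVal R r := by
    intro n
    rw [← DiophantineGeometry.TateAlgorithm.pow_dvd_iff_le_addVal,
      ← DiophantineGeometry.TateAlgorithm.mem_maximalIdeal_pow_iff_dvd,
      ← Int.ofNat_le, ← neg_le_neg_iff, ← WithZero.exp_le_exp, ← h]
    exact (IsDiscreteValuationRing.maximalIdeal R).intValuation_le_pow_iff_mem r n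
  obtain ⟨m, hm⟩ := ENat.ne_top_iff_exists.mp
    (mt IsDiscreteValuationRing.addVal_eq_top_iff.mp hr)
  rw [← hm, ENat.toNat_coe]
  simp_rw [← hm, Nat.cast_le] at key
  exact le_antisymm ((key m).mpr le_rfl) ((key c).mp le_rfl)

variable {v W} in
/-- **Bridge from `KodairaNeron.lean` (split multiplicative case).** The named fact
`WeierstrassCurve.index_goodReductionSubgroup_of_hasSplitMultiplicativeReduction` (Silverman,
*ATAEC*, Cor. IV.9.2(d) with (b): over a Henselian discrete valuation ring with perfect residue
field, split multiplicative reduction gives `E(K)/E₀(K)` cyclic with `v(Δ) = exp(−[E(K) : E₀(K)])`)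
applies to `R := O_v` — Henselian because complete
(`IsDedekindDomain.HeightOneSpectrum.adicCompletionIntegers.isAdicComplete`,
`IsAdicComplete.henselianRing`) — and `W := W.localMinimalModel v`, and yields
`c_v = ord_v(Δ_min)`: the discriminant of the local minimal model is that of its integral model
(`integralModel_Δ_eq`), whose valuation is `exp(−ord_v(Δ_min))`
(`toNat_addVal_eq_of_intValuation_eq`). [cite: SilvermanATAEC1994, Cor. IV.9.2(d) (PDF p. 340)] -/
theorem localTamagawaNumber_eq_ordMinimalDiscriminant_of_kodairaNeron [W.IsElliptic]
    [PerfectField (IsLocalRing.ResidueField (v.adicCompletionIntegers K))]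
    (hKN : (W.localMinimalModel v).index_goodReductionSubgroup_of_hasSplitMultiplicativeReduction
      (v.adicCompletionIntegers K))
    (hs : W.HasSplitMultiplicativeReductionAt v) :
    (W.baseChange (v.adicCompletion K)).localTamagawaNumber (v.adicCompletionIntegers K) =
      W.ordMinimalDiscriminant v := by
  haveI : (W.localMinimalModel v).HasSplitMultiplicativeReduction (v.adicCompletionIntegers K) :=
    hs
  haveI := W.isElliptic_localMinimalModel v
  obtain ⟨-, hval⟩ := hKN
  rw [← WeierstrassCurve.integralModel_Δ_eq (v.adicCompletionIntegers K) (W.localMinimalModel v),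
    IsDedekindDomain.HeightOneSpectrum.valuation_of_algebraMap] at hval
  have hne : (W.localMinimalIntegralModel v).Δ ≠ 0 := by
    intro h0
    apply (W.localMinimalModel v).Δ'.ne_zero
    rw [(W.localMinimalModel v).coe_Δ',
      ← WeierstrassCurve.integralModel_Δ_eq (v.adicCompletionIntegers K) (W.localMinimalModel v)]
    change algebraMap _ _ (W.localMinimalIntegralModel v).Δ = 0
    rw [h0, map_zero]
  exact (toNat_addVal_eq_of_intValuation_eq hne hval).symm

/-- **Assembly of `nonempty_neronComponentData` from the local index table.** The nine named
facts of `NeronComponentIndex.lean` (the values of `c` in Steps 2–10 of Tate's algorithm,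
Silverman, *ATAEC*, IV.9.4, read over the complete field `K_v`), the split multiplicative case as
the `KodairaNeron` fact `index_goodReductionSubgroup_of_hasSplitMultiplicativeReduction` at
`(O_v, W.localMinimalModel v)`, Step 1 (`c = 1` for good reduction, proved in the tree) and the
characterisation of Steps 1–2 by the reduction type
(`WeierstrassCurve.isGood_kodairaSymbolAt_iff_holds`,
`WeierstrassCurve.kodairaSymbolAt_eq_I_iff_holds`) imply the existence of Néron component-group
data at `v` (finite residue field, so the perfectness the facts ask for is Mathlib's
`PerfectField.ofFinite`): case analysis on `W.kodairaSymbolAt v`, then one of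
`nonempty_neronComponentData_of_eq_componentGroupOrder`, `nonempty_neronComponentData_of_neg`,
`nonempty_neronComponentData_of_klein`.
[cite: SilvermanATAEC1994, IV.9.4 (PDF pp. 341–346) with Cor. IV.9.2 (PDF p. 340)] -/
theorem nonempty_neronComponentData_of_localIndex
    (hII : localTamagawaNumber_eq_one_of_kodairaSymbolAt_eq_II v W)
    (hIII : localTamagawaNumber_eq_two_of_kodairaSymbolAt_eq_III v W)
    (hIV : localTamagawaNumber_of_kodairaSymbolAt_eq_IV v W)
    (hI0s : localTamagawaNumber_of_kodairaSymbolAt_eq_Istar_zero v W)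
    (hIns : localTamagawaNumber_of_kodairaSymbolAt_eq_Istar_succ v W)
    (hIVs : localTamagawaNumber_of_kodairaSymbolAt_eq_IVstar v W)
    (hIIIs : localTamagawaNumber_eq_two_of_kodairaSymbolAt_eq_IIIstar v W)
    (hIIs : localTamagawaNumber_eq_one_of_kodairaSymbolAt_eq_IIstar v W)
    (hKN : (W.localMinimalModel v).index_goodReductionSubgroup_of_hasSplitMultiplicativeReduction
      (v.adicCompletionIntegers K))
    (hns : localTamagawaNumber_of_hasNonsplitMultiplicativeReductionAt v W) :
    nonempty_neronComponentData W v := by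
  intro _ _
  rcases hk : W.kodairaSymbolAt v with (_ | m) | _ | _ | _ | (_ | n) | _ | _ | _
  · -- `I₀`: good reduction, `c = 1` (Step 1, proved in the tree)
    have hg : W.HasGoodReductionAt v :=
      (WeierstrassCurve.isGood_kodairaSymbolAt_iff_holds v W).mp hk
    refine nonempty_neronComponentData_of_eq_componentGroupOrder ?_
    rw [hk, localTamagawaNumber_eq_one_of_good' v W
      (WeierstrassCurve.localTamagawaNumber_eq_one_of_hasGoodReduction_holds _ _) hg]
    rfl
  · -- `Iₘ₊₁`: multiplicative reduction, `m + 1 = ord_v(Δ_min)` (Step 2)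
    obtain ⟨hmult, hord⟩ :=
      (WeierstrassCurve.kodairaSymbolAt_eq_I_iff_holds v W m.succ_ne_zero).mp hk
    by_cases hs : W.HasSplitMultiplicativeReductionAt v
    · refine nonempty_neronComponentData_of_eq_componentGroupOrder ?_
      rw [localTamagawaNumber_eq_ordMinimalDiscriminant_of_kodairaNeron hKN hs, hord, hk,
        DiophantineGeometry.KodairaSymbol.componentGroupOrder_I]
      exact (max_eq_left m.succ_pos).symm
    · have hcgo : (W.kodairaSymbolAt v).componentGroupOrder = m + 1 := by
        rw [hk, DiophantineGeometry.KodairaSymbol.componentGroupOrder_I]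
        exact max_eq_left m.succ_pos
      refine nonempty_neronComponentData_of_neg (by rw [hcgo]; exact m.succ_ne_zero) ?_
      rw [hns hmult hs, hord, hcgo]
  · -- `II`
    exact nonempty_neronComponentData_of_eq_componentGroupOrder (by rw [hII hk, hk]; rfl)
  · -- `III`
    exact nonempty_neronComponentData_of_eq_componentGroupOrder (by rw [hIII hk, hk]; rfl)
  · -- `IV`
    rcases hIV hk with h | h
    · exact nonempty_neronComponentData_of_neg (by rw [hk]; decide) (by rw [h, hk]; decide)
    · exact nonempty_neronComponentData_of_eq_componentGroupOrder (by rw [h, hk]; rfl)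
  · -- `I₀*`
    rcases hI0s hk with h | h | h
    · exact nonempty_neronComponentData_of_klein (by rw [hk]; rfl) h
    · exact nonempty_neronComponentData_of_neg (by rw [hk]; decide) (by rw [h, hk]; decide)
    · exact nonempty_neronComponentData_of_eq_componentGroupOrder (by rw [h, hk]; rfl)
  · -- `Iₙ₊₁*`
    rcases hIns n hk with h | h
    · exact nonempty_neronComponentData_of_neg
        (by rw [hk, DiophantineGeometry.KodairaSymbol.componentGroupOrder_Istar]; decide)
        (by rw [h, hk, DiophantineGeometry.KodairaSymbol.componentGroupOrder_Istar]; decide)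
    · exact nonempty_neronComponentData_of_eq_componentGroupOrder (by rw [h, hk]; rfl)
  · -- `IV*`
    rcases hIVs hk with h | h
    · exact nonempty_neronComponentData_of_neg (by rw [hk]; decide) (by rw [h, hk]; decide)
    · exact nonempty_neronComponentData_of_eq_componentGroupOrder (by rw [h, hk]; rfl)
  · -- `III*`
    exact nonempty_neronComponentData_of_eq_componentGroupOrder (by rw [hIIIs hk, hk]; rfl)
  · -- `II*`
    exact nonempty_neronComponentData_of_eq_componentGroupOrder (by rw [hIIs hk, hk]; rfl)

end Assembly

end Literature.NumberTheory.EllipticCurves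

end
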